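import Literature.MathematicalPhysics.QuantumFieldTheory.ConformalBootstrap3D.BlockCoefficientExtraction
import Mathlib.Analysis.SpecificLimits.Normed
import Mathlib.Analysis.Normed.Ring.InfiniteSum
import Mathlib.Tactic
import HarnessLib

/-!
# Existence of the 3D conformal block above the unitarity bound: the Hogervorst–Rychkov `z`-series converges on the unit bidisk and solves the Casimir equation

pub-ising3d, the paper's Limitation (a) "satisfiability of A2": the typed bootstrap axioms
(`SigmaEpsilonSystem`) quantify over functions satisfying the block predicate `IsConformalBlock3D`, and
every exclusion theorem is silently conditional on that predicate having a solution at each admissible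
`(Δ, ℓ)` — otherwise A2 would force such operators to be absent. This file PROVES the existence for the
equal-external-dimension family (`Δ₁₂ = Δ₃₄ = 0`: the `σσσσ` and `εεεε` channels) at every regular point
strictly above the unitarity bound:

* `isConformalBlock3DAbove_hrBlock` — for every `Δ > unitarityBound3D ℓ` the function
  `hrBlock Δ ℓ (z, z̄) = (z z̄)^{(Δ-ℓ)/2} Σ_{m,n} k^{HR}_{mn} z^m z̄^n`, `k^{HR} = hrMonomialCoeff Δ ℓ` the
  Hogervorst–Rychkov array in Dolan–Osborn normalisation (`BlockCoefficientExistence`), satisfies the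
  generic predicate `IsConformalBlock3DAbove 0 0 Δ ℓ` (accidental degeneracies included);
* `isConformalBlock3D_hrBlock`, `exists_isConformalBlock3D` — hence `IsConformalBlock3D 0 0 Δ ℓ` at every
  regular point; with the uniqueness theorem of `BlockCoefficientExtraction` the genuine block there IS
  `hrBlock` (`IsConformalBlock3D.eq_hrBlock`); `hrBlock_pos` — it is positive on the open square.

The two analytic inputs, both proved here:

1. **Convergence on the unit bidisk** (`isDoublePowerSeriesOn_hrSeries`,
   `summable_hrMonomialCoeff_mul_pow`). Hogervorst–Rychkov (§2.1, after eq. (2.16)) state that the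
   `z`-series converges for `|z| < 1`, from the operator (OPE / radial-quantisation) picture; for the
   recursively defined array a proof is needed, and we give an elementary one from the recursion alone:
   the diagonal level sums `a_n = Σ_j A_{n,j}` grow at most polynomially (`hrLevelSum_le_quartic`:
   `a_n ≤ C (n+1)(n+2)(n+3)(n+4)`). Mechanism: read the recursion (2.27) column-wise,
   `a_{n+1} = Σ_j W(n,j) A_{n,j}` with the transfer weight
   `W(n,j) = γ⁺_{Δ+n,j}/(C_{Δ+n+1,j+1}-C_{Δ,ℓ}) + γ⁻_{Δ+n,j}/(C_{Δ+n+1,j-1}-C_{Δ,ℓ})`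
   (`hrLevelSum_succ_eq_sum_transfer`); the numerator of `W - 1` has degree `4` in `(n, j)` against `5`
   for its denominator (`W - 1 ≈ n(n²-3j²)/(n²+j²)²`), and for `n ≥ (Δ+ℓ+2)²` one has the uniform bound
   `W(n,j) ≤ 1 + 4/(n+1)` (`hrTransferWeight_le`) — a polynomial inequality certified by exhibiting, after
   the shift `n = (Δ+ℓ+2)² + m`, `j = 1 + i`, a polynomial with non-negative coefficients (§2; generated
   by computer algebra, checked by `ring`/`positivity`). Since `(1 + 4/(n+1)) q(n) = q(n+1)` for
   `q(n) = (n+1)(n+2)(n+3)(n+4)`, induction gives the quartic bound; with `k ≥ 0`,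
   `k_{mn} ≤ d_{m+n} ≤ C' q(m+n) ≤ C' q(m) q(n)` and `Σ q(m) t^m < ∞` the double series converges
   absolutely for `|z|, |z̄| ≤ t < 1`.
2. **The coefficient system implies the Casimir PDE** (`casimirEq3D_of_satisfiesCoeffCasimir`, all
   external dimensions): the converse of the extraction theorem `satisfiesCoeffCasimir_of_casimirEq3D`,
   by the same termwise differentiation of generalised power series and the same reindexing of the five
   shifted families, read backwards (every coefficient `E_{PQ}` of the Casimir expression vanishes, so the
   expression is `(z z̄)^α · 0`). Combined with `hrMonomialCoeff_satisfies` (the HR array solves the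
   system, `BlockCoefficientExistence`) this gives the PDE for `hrBlock`.

What is NOT here: unequal external dimensions (the `σε` channels, array `hrCoeffAB`: the same transfer
argument applies to the three-term recursion but is not carried out); the limit clause of
`IsConformalBlock3D` at non-regular points (unitarity bound, accidental degeneracies), which needs
continuity of `hrBlock` in `Δ`; any numerical value. No new hypothesis-style fact is introduced.

Sources: M. Hogervorst, S. Rychkov, "Radial coordinates for conformal blocks", Phys. Rev. D 87 (2013)
106004 [arXiv:1303.1111], §2.1 eq. (2.16) (the `z`-series and its region of convergence `|z| < 1`),
§2.2 eqs. (2.26)–(2.27) (`γ±`, the recursion; arXiv-v2 numbering); F. A. Dolan, H. Osborn,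
arXiv:1108.6194 (2011), §2 eqs. (2.9)–(2.12) (Casimir equation, boundary condition). The growth
estimate of §1–§3 is ours (elementary; Hogervorst–Rychkov's convergence statement rests on the Hilbert-space
interpretation, not on the recursion). Mathlib: `summable_pow_mul_geometric_of_norm_lt_one`,
`Summable.mul_of_nonneg`, `HasSum.unique`.
-/

namespace Literature.MathematicalPhysics.QuantumFieldTheory.ConformalBootstrap3D

open Finset Set Filter Topology

/-! ### 1. The level-sum transfer weight -/

/-- The **transfer weight** of the Hogervorst–Rychkov recursion for the diagonal level sums:
`W(n,j) = γ⁺_{Δ+n,j}/(C_{Δ+n+1,j+1} - C_{Δ,ℓ}) + γ⁻_{Δ+n,j}/(C_{Δ+n+1,j-1} - C_{Δ,ℓ})`, the total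
weight with which the level-`n` coefficient `A_{n,j}` enters the level-`(n+1)` sum `Σ_j A_{n+1,j}`
(the recursion of Hogervorst–Rychkov read column-wise; for `j = 0` the second term vanishes because
`γ⁻_{E,0} = 0`). [cite: HogervorstRychkov2013, §2.2 eq. (2.27)] -/
noncomputable def hrTransferWeight (Δ : ℝ) (ℓ n j : ℕ) : ℝ :=
  hrGammaPlus (Δ + n) j / casimirPivot3D Δ ℓ (n + 1) (j + 1) +
    hrGammaMinus (Δ + n) j / casimirPivot3D Δ ℓ (n + 1) (j - 1)

/-- **Column-wise form of the recursion**: `Σ_{j ≤ ℓ+n+1} A_{n+1,j} = Σ_{j ≤ ℓ+n} W(n,j) A_{n,j}`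
(exchange "child ← parents" for "parent → children" in the recursion; the would-be parents
`A_{n,ℓ+n+1}, A_{n,ℓ+n+2}` of the two top children vanish). [cite: HogervorstRychkov2013, §2.2 eq. (2.27)] -/
theorem hrLevelSum_succ_eq_sum_transfer (Δ : ℝ) (ℓ n : ℕ) :
    hrLevelSum Δ ℓ (n + 1) =
      ∑ j ∈ range (ℓ + n + 1), hrTransferWeight Δ ℓ n j * hrCoeff Δ ℓ n j := by
  unfold hrLevelSum
  have hN : ℓ + (n + 1) + 1 = (ℓ + n + 1) + 1 := by omega
  rw [hN, Finset.sum_congr rfl fun j _ => hrCoeff_succ Δ ℓ n j]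
  simp_rw [add_div, Finset.sum_add_distrib]
  rw [Finset.sum_range_succ' (fun j => (if j = 0 then (0 : ℝ) else
      hrGammaPlus (Δ + n) (j - 1) * hrCoeff Δ ℓ n (j - 1)) / casimirPivot3D Δ ℓ (n + 1) j)]
  simp only [Nat.add_one_ne_zero, if_false, Nat.add_sub_cancel, if_true, zero_div, add_zero]
  rw [Finset.sum_range_succ (fun j => hrGammaMinus (Δ + n) (j + 1) * hrCoeff Δ ℓ n (j + 1) /
      casimirPivot3D Δ ℓ (n + 1) j), Finset.sum_range_succ (fun j => hrGammaMinus (Δ + n) (j + 1) *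
      hrCoeff Δ ℓ n (j + 1) / casimirPivot3D Δ ℓ (n + 1) j),
    hrCoeff_eq_zero_of_lt Δ (show ℓ + n < ℓ + n + 1 by omega),
    hrCoeff_eq_zero_of_lt Δ (show ℓ + n < ℓ + n + 1 + 1 by omega)]
  simp only [mul_zero, zero_div, add_zero]
  simp_rw [hrTransferWeight, add_mul, Finset.sum_add_distrib]
  congr 1
  · exact Finset.sum_congr rfl fun j _ => by ring
  · rw [Finset.sum_range_succ' (fun j => hrGammaMinus (Δ + n) j /
        casimirPivot3D Δ ℓ (n + 1) (j - 1) * hrCoeff Δ ℓ n j)]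
    simp only [hrGammaMinus_zero, zero_div, zero_mul, add_zero, Nat.add_sub_cancel]
    exact Finset.sum_congr rfl fun j _ => by ring

/-! ### 2. Polynomial certificates

For `n ≥ (Δ+ℓ+2)²` the transfer weights satisfy `W(n,j) ≤ 1 + 4/(n+1)`. Clearing denominators this is
a polynomial inequality in `(n, j, Δ, ℓ)`; after the substitutions `n = (Δ+ℓ+2)² + m`, `j = 1 + i`
(`m, i ≥ 0`) the difference of the two sides is a polynomial with non-negative integer coefficients in
`(m, i, Δ, ℓ)` (236 monomials; found by computer algebra, pub-ising3d-lit-g6 `code/gen_cert.py`),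
which `ring` + `positivity` verify below. The exact degree drop behind it: with `E = Δ+n`,
`P± = C_{Δ+n+1,j±1} - C_{Δ,ℓ}`, the numerator `(E+j)²(j+1)P₋ + (E-j-1)²jP₊` of `W` minus its
denominator `(2j+1)P₊P₋` has degree `4` in `(n,j)` (top part `2n³j - 6nj³`) against degree `5` for the
denominator (top part `2j(n²+j²)²`): `W - 1 ≈ n(n²-3j²)/(n²+j²)² ≤ 1/n`. -/

set_option maxHeartbeats 4000000 in
/-- The certificate for `j ≥ 1`, in the shifted variables `n = (Δ+L+2)²+m`, `j = 1+i`. [folklore] -/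
theorem hrTransfer_cert_shifted (m i Δ L : ℝ) (hm : 0 ≤ m) (hi : 0 ≤ i) (hΔ : 0 ≤ Δ) (hL : 0 ≤ L) :
    0 ≤ ((Δ + L + 2) ^ 2 + m + 5) * ((2 * (1 + i) + 1) *
      (2 * ((Δ + L + 2) ^ 2 + m + 1) * Δ + ((Δ + L + 2) ^ 2 + m + 1) * ((Δ + L + 2) ^ 2 + m + 1 - 3)
        + (1 + i + 1) * (1 + i + 2) - L * (L + 1)) *
      (2 * ((Δ + L + 2) ^ 2 + m + 1) * Δ + ((Δ + L + 2) ^ 2 + m + 1) * ((Δ + L + 2) ^ 2 + m + 1 - 3)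
        + (1 + i - 1) * (1 + i) - L * (L + 1)))
    - ((Δ + L + 2) ^ 2 + m + 1) * ((Δ + ((Δ + L + 2) ^ 2 + m) + (1 + i)) ^ 2 * (1 + i + 1) *
        (2 * ((Δ + L + 2) ^ 2 + m + 1) * Δ + ((Δ + L + 2) ^ 2 + m + 1) * ((Δ + L + 2) ^ 2 + m + 1 - 3)
          + (1 + i - 1) * (1 + i) - L * (L + 1)) +
      (Δ + ((Δ + L + 2) ^ 2 + m) - (1 + i) - 1) ^ 2 * (1 + i) *
        (2 * ((Δ + L + 2) ^ 2 + m + 1) * Δ + ((Δ + L + 2) ^ 2 + m + 1) * ((Δ + L + 2) ^ 2 + m + 1 - 3)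
          + (1 + i + 1) * (1 + i + 2) - L * (L + 1))) := by
  obtain ⟨c0, hc0⟩ : ∃ c : ℝ, c = (4 : ℝ) * i * L^8 + (36 : ℝ) * i * Δ * L^7 + (136 : ℝ) * i * Δ^2 * L^6 + (284 : ℝ) * i * Δ^3 * L^5 + (360 : ℝ) * i * Δ^4 * L^4 + (284 : ℝ) * i * Δ^5 * L^3 + (136 : ℝ) * i * Δ^6 * L^2 + (36 : ℝ) * i * Δ^7 * L + (4 : ℝ) * i * Δ^8 + (6 : ℝ) * L^8 + (54 : ℝ) * Δ * L^7 + (204 : ℝ) * Δ^2 * L^6 + (426 : ℝ) * Δ^3 * L^5 + (540 : ℝ) * Δ^4 * L^4 + (426 : ℝ) * Δ^5 * L^3 + (204 : ℝ) * Δ^6 * L^2 + (54 : ℝ) * Δ^7 * L + (6 : ℝ) * Δ^8 + (70 : ℝ) * i * L^7 + (568 : ℝ) * i * Δ * L^6 + (1898 : ℝ) * i * Δ^2 * L^5 + (3412 : ℝ) * i * Δ^3 * L^4 + (3578 : ℝ) * i * Δ^4 * L^3 + (2192 : ℝ) * i * Δ^5 * L^2 + (726 : ℝ) * i * Δ^6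 * L + (100 : ℝ) * i * Δ^7 + (18 : ℝ) * m * i * L^6 + (120 : ℝ) * m * i * Δ * L^5 + (318 : ℝ) * m * i * Δ^2 * L^4 + (432 : ℝ) * m * i * Δ^3 * L^3 + (318 : ℝ) * m * i * Δ^4 * L^2 + (120 : ℝ) * m * i * Δ^5 * L + (18 : ℝ) * m * i * Δ^6 + (105 : ℝ) * L^7 + (852 : ℝ) * Δ * L^6 + (2847 : ℝ) * Δ^2 * L^5 + (5118 : ℝ) * Δ^3 * L^4 + (5367 : ℝ) * Δ^4 * L^3 + (3288 : ℝ) * Δ^5 * L^2 + (1089 : ℝ) * Δ^6 * L := ⟨_, rfl⟩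
  have p0 : 0 ≤ c0 := by rw [hc0]; positivity
  obtain ⟨c1, hc1⟩ : ∃ c : ℝ, c = (150 : ℝ) * Δ^7 + (500 : ℝ) * i * L^6 + (3632 : ℝ) * i * Δ * L^5 + (10528 : ℝ) * i * Δ^2 * L^4 + (15716 : ℝ) * i * Δ^3 * L^3 + (12804 : ℝ) * i * Δ^4 * L^2 + (5412 : ℝ) * i * Δ^5 * L + (928 : ℝ) * i * Δ^6 + (20 : ℝ) * i^3 * L^4 + (84 : ℝ) * i^3 * Δ * L^3 + (128 : ℝ) * i^3 * Δ^2 * L^2 + (84 : ℝ) * i^3 * Δ^3 * L + (20 : ℝ) * i^3 * Δ^4 + (27 : ℝ) * m * L^6 + (180 : ℝ) * m * Δ * L^5 + (477 : ℝ) * m * Δ^2 * L^4 + (648 : ℝ) * m * Δ^3 * L^3 + (477 : ℝ) * m * Δ^4 * L^2 + (180 : ℝ) * m * Δ^5 * L + (27 : ℝ) * m * Δ^6 + (234 : ℝ) * m * i * L^5 + (1360 : ℝ) * m * i * Δ * L^4 + (3020 : ℝ) * m * i * Δ^2 * L^3 + (3224 : ℝ) * m * i * Δ^3 * L^2 + (1658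 : ℝ) * m * i * Δ^4 * L + (328 : ℝ) * m * i * Δ^5 + (30 : ℝ) * m^2 * i * L^4 + (132 : ℝ) * m^2 * i * Δ * L^3 + (204 : ℝ) * m^2 * i * Δ^2 * L^2 + (132 : ℝ) * m^2 * i * Δ^3 * L + (30 : ℝ) * m^2 * i * Δ^4 + (750 : ℝ) * L^6 + (5448 : ℝ) * Δ * L^5 + (15792 : ℝ) * Δ^2 * L^4 + (23574 : ℝ) * Δ^3 * L^3 + (19206 : ℝ) * Δ^4 * L^2 + (8118 : ℝ) * Δ^5 * L + (1392 : ℝ) * Δ^6 + (1942 : ℝ) * i * L^5 + (12404 : ℝ) * i * Δ * L^4 := ⟨_, rfl⟩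
  have p1 : 0 ≤ c1 := by rw [hc1]; positivity
  obtain ⟨c2, hc2⟩ : ∃ c : ℝ, c = (30146 : ℝ) * i * Δ^2 * L^3 + (35136 : ℝ) * i * Δ^3 * L^2 + (19756 : ℝ) * i * Δ^4 * L + (4304 : ℝ) * i * Δ^5 + (90 : ℝ) * i^2 * L^4 + (378 : ℝ) * i^2 * Δ * L^3 + (576 : ℝ) * i^2 * Δ^2 * L^2 + (378 : ℝ) * i^2 * Δ^3 * L + (90 : ℝ) * i^2 * Δ^4 + (166 : ℝ) * i^3 * L^3 + (560 : ℝ) * i^3 * Δ * L^2 + (606 : ℝ) * i^3 * Δ^2 * L + (212 : ℝ) * i^3 * Δ^3 + (351 : ℝ) * m * L^5 + (2040 : ℝ) * m * Δ * L^4 + (4530 : ℝ) * m * Δ^2 * L^3 + (4836 : ℝ) * m * Δ^3 * L^2 + (2487 : ℝ) * m * Δ^4 * L + (492 : ℝ) * m * Δ^5 + (1174 : ℝ) * m * i * L^4 + (5808 : ℝ) * m * i * Δ * L^3 + (10230 : ℝ) * m * i * Δ^2 * L^2 + (7656 : ℝ) * m * i * Δ^3 * L + (2064 : ℝ) * m *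 i * Δ^4 + (42 : ℝ) * m * i^3 * L^2 + (88 : ℝ) * m * i^3 * Δ * L + (42 : ℝ) * m * i^3 * Δ^2 + (45 : ℝ) * m^2 * L^4 + (198 : ℝ) * m^2 * Δ * L^3 + (306 : ℝ) * m^2 * Δ^2 * L^2 + (198 : ℝ) * m^2 * Δ^3 * L + (45 : ℝ) * m^2 * Δ^4 + (258 : ℝ) * m^2 * i * L^3 + (920 : ℝ) * m^2 * i * Δ * L^2 + (1026 : ℝ) * m^2 * i * Δ^2 * L + (356 : ℝ) * m^2 * i * Δ^3 + (22 : ℝ) * m^3 * i * L^2 + (48 : ℝ) * m^3 * i * Δ * L + (22 : ℝ) * m^3 * i * Δ^2 + (2913 : ℝ) * L^5 := ⟨_, rfl⟩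
  have p2 : 0 ≤ c2 := by rw [hc2]; positivity
  obtain ⟨c3, hc3⟩ : ∃ c : ℝ, c = (18606 : ℝ) * Δ * L^4 + (45219 : ℝ) * Δ^2 * L^3 + (52704 : ℝ) * Δ^3 * L^2 + (29634 : ℝ) * Δ^4 * L + (6456 : ℝ) * Δ^5 + (4700 : ℝ) * i * L^4 + (25330 : ℝ) * i * Δ * L^3 + (48462 : ℝ) * i * Δ^2 * L^2 + (39154 : ℝ) * i * Δ^3 * L + (11350 : ℝ) * i * Δ^4 + (747 : ℝ) * i^2 * L^3 + (2520 : ℝ) * i^2 * Δ * L^2 + (2727 : ℝ) * i^2 * Δ^2 * L + (954 : ℝ) * i^2 * Δ^3 + (472 : ℝ) * i^3 * L^2 + (1180 : ℝ) * i^3 * Δ * L + (672 : ℝ) * i^3 * Δ^2 + (8 : ℝ) * i^5 + (1761 : ℝ) * m * L^4 + (8712 : ℝ) * m * Δ * L^3 + (15345 : ℝ) * m * Δ^2 * L^2 + (11484 : ℝ) * m * Δ^3 * L + (3096 : ℝ) * m * Δ^4 + (2984 : ℝ) * m * i * L^3 + (11900 : ℝ) * m * i * Δ * L^2 + (14870 :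 ℝ) * m * i * Δ^2 * L + (5832 : ℝ) * m * i * Δ^3 + (189 : ℝ) * m * i^2 * L^2 + (396 : ℝ) * m * i^2 * Δ * L + (189 : ℝ) * m * i^2 * Δ^2 + (174 : ℝ) * m * i^3 * L + (220 : ℝ) * m * i^3 * Δ + (387 : ℝ) * m^2 * L^3 + (1380 : ℝ) * m^2 * Δ * L^2 + (1539 : ℝ) * m^2 * Δ^2 * L + (534 : ℝ) * m^2 * Δ^3 + (754 : ℝ) * m^2 * i * L^2 + (1988 : ℝ) * m^2 * i * Δ * L + (1216 : ℝ) * m^2 * i * Δ^2 + (22 : ℝ) * m^2 * i^3 := ⟨_, rfl⟩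
  have p3 : 0 ≤ c3 := by rw [hc3]; positivity
  obtain ⟨c4, hc4⟩ : ∃ c : ℝ, c = (33 : ℝ) * m^3 * L^2 + (72 : ℝ) * m^3 * Δ * L + (33 : ℝ) * m^3 * Δ^2 + (94 : ℝ) * m^3 * i * L + (128 : ℝ) * m^3 * i * Δ + (6 : ℝ) * m^4 * i + (6915 : ℝ) * L^4 + (37428 : ℝ) * Δ * L^3 + (71829 : ℝ) * Δ^2 * L^2 + (58164 : ℝ) * Δ^3 * L + (16890 : ℝ) * Δ^4 + (7771 : ℝ) * i * L^3 + (32680 : ℝ) * i * Δ * L^2 + (43437 : ℝ) * i * Δ^2 * L + (18102 : ℝ) * i * Δ^3 + (2124 : ℝ) * i^2 * L^2 + (5310 : ℝ) * i^2 * Δ * L + (3024 : ℝ) * i^2 * Δ^2 + (590 : ℝ) * i^3 * L + (836 : ℝ) * i^3 * Δ + (60 : ℝ) * i^4 + (4476 : ℝ) * m * L^3 + (17850 : ℝ) * m * Δ * L^2 + (22305 : ℝ) * m * Δ^2 * L + (8748 : ℝ) * m * Δ^3 + (4391 : ℝ) * m * i * L^2 + (12408 : ℝ) * m * i * Δ *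 L + (8195 : ℝ) * m * i * Δ^2 + (783 : ℝ) * m * i^2 * L + (990 : ℝ) * m * i^2 * Δ + (154 : ℝ) * m * i^3 + (1131 : ℝ) * m^2 * L^2 + (2982 : ℝ) * m^2 * Δ * L + (1824 : ℝ) * m^2 * Δ^2 + (922 : ℝ) * m^2 * i * L + (1336 : ℝ) * m^2 * i * Δ + (99 : ℝ) * m^2 * i^2 + (141 : ℝ) * m^3 * L + (192 : ℝ) * m^3 * Δ + (80 : ℝ) * m^3 * i := ⟨_, rfl⟩
  have p4 : 0 ≤ c4 := by rw [hc4]; positivity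
  obtain ⟨c5, hc5⟩ : ∃ c : ℝ, c = (9 : ℝ) * m^4 + (10536 : ℝ) * L^3 + (45240 : ℝ) * Δ * L^2 + (61065 : ℝ) * Δ^2 * L + (25722 : ℝ) * Δ^3 + (8998 : ℝ) * i * L^2 + (25990 : ℝ) * i * Δ * L + (17720 : ℝ) * i * Δ^2 + (2655 : ℝ) * i^2 * L + (3762 : ℝ) * i^2 * Δ + (380 : ℝ) * i^3 + (6303 : ℝ) * m * L^2 + (18018 : ℝ) * m * Δ * L + (12009 : ℝ) * m * Δ^2 + (4003 : ℝ) * m * i * L + (5878 : ℝ) * m * i * Δ + (693 : ℝ) * m * i^2 + (1383 : ℝ) * m^2 * L + (2004 : ℝ) * m^2 * Δ + (525 : ℝ) * m^2 * i + (120 : ℝ) * m^3 + (10311 : ℝ) * L^2 + (31020 : ℝ) * Δ * L + (22044 : ℝ) * Δ^2 + (6687 : ℝ) * i * L + (10082 : ℝ) * i * Δ + (1170 : ℝ) * i^2 + (4830 : ℝ) * m * L + (7332 : ℝ) * m * Δ + (1773 : ℝ) * m * i + (639 : ℝ) * m^2 + (6048 : ℝ) * L + (9480 : ℝ) * Δ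 + (2062 : ℝ) * i + (1620 : ℝ) * m + (1500 : ℝ) := ⟨_, rfl⟩
  have p5 : 0 ≤ c5 := by rw [hc5]; positivity
  have key : ((Δ + L + 2) ^ 2 + m + 5) * ((2 * (1 + i) + 1) * (2 * ((Δ + L + 2) ^ 2 + m + 1) * Δ + ((Δ + L + 2) ^ 2 + m + 1) * ((Δ + L + 2) ^ 2 + m + 1 - 3) + (1 + i + 1) * (1 + i + 2) - L * (L + 1)) * (2 * ((Δ + L + 2) ^ 2 + m + 1) * Δ + ((Δ + L + 2) ^ 2 + m + 1) * ((Δ + L + 2) ^ 2 + m + 1 - 3) + (1 + i - 1) * (1 + i) - L * (L + 1))) - ((Δ + L + 2) ^ 2 + m + 1) * ((Δ + ((Δ + L + 2) ^ 2 + m) + (1 + i)) ^ 2 * (1 + i + 1) * (2 * ((Δ + L + 2) ^ 2 + m + 1) * Δ + ((Δ + L + 2) ^ 2 + m + 1) * ((Δ + L + 2) ^ 2 + m + 1 - 3) + (1 + i - 1) * (1 + i) - L * (L + 1)) + (Δ + ((Δ + L + 2) ^ 2 + m) - (1 + i) - 1) ^ 2 * (1 + i) * (2 * ((Δ + L + 2)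 ^ 2 + m + 1) * Δ + ((Δ + L + 2) ^ 2 + m + 1) * ((Δ + L + 2) ^ 2 + m + 1 - 3) + (1 + i + 1) * (1 + i + 2) - L * (L + 1))) = c0 + c1 + c2 + c3 + c4 + c5 := by
    rw [hc0, hc1, hc2, hc3, hc4, hc5]; ring
  rw [key]; positivity

/-- The certificate for `j = 0`, in the shifted variables. [folklore] -/
theorem hrTransfer_cert_zero_shifted (m Δ L : ℝ) (hm : 0 ≤ m) (hΔ : 0 ≤ Δ) (hL : 0 ≤ L) :
    0 ≤ ((Δ + L + 2) ^ 2 + m + 5) *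
        (2 * ((Δ + L + 2) ^ 2 + m + 1) * Δ + ((Δ + L + 2) ^ 2 + m + 1) * ((Δ + L + 2) ^ 2 + m + 1 - 3)
          + 1 * (1 + 1) - L * (L + 1))
      - ((Δ + L + 2) ^ 2 + m + 1) * (Δ + ((Δ + L + 2) ^ 2 + m)) ^ 2 := by
  have key : ((Δ + L + 2) ^ 2 + m + 5) *
        (2 * ((Δ + L + 2) ^ 2 + m + 1) * Δ + ((Δ + L + 2) ^ 2 + m + 1) * ((Δ + L + 2) ^ 2 + m + 1 - 3)
          + 1 * (1 + 1) - L * (L + 1))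
      - ((Δ + L + 2) ^ 2 + m + 1) * (Δ + ((Δ + L + 2) ^ 2 + m)) ^ 2 = (2 : ℝ) * L^4 + (10 : ℝ) * Δ * L^3 + (16 : ℝ) * Δ^2 * L^2 + (10 : ℝ) * Δ^3 * L + (2 : ℝ) * Δ^4 + (19 : ℝ) * L^3 + (76 : ℝ) * Δ * L^2 + (87 : ℝ) * Δ^2 * L + (30 : ℝ) * Δ^3 + (5 : ℝ) * m * L^2 + (12 : ℝ) * m * Δ * L + (5 : ℝ) * m * Δ^2 + (54 : ℝ) * L^2 + (170 : ℝ) * Δ * L + (102 : ℝ) * Δ^2 + (23 : ℝ) * m * L + (34 : ℝ) * m * Δ + (3 : ℝ) * m^2 + (67 : ℝ) * L + (126 : ℝ) * Δ + (19 : ℝ) * m + (28 : ℝ) := by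
    ring
  rw [key]
  positivity

/-- The pivot certificate: for `n ≥ (Δ+ℓ+2)²` the spin-`0` pivot of level `n+1` is `≥ 1`. [folklore] -/
theorem hrPivot_cert_shifted (m Δ L : ℝ) (hm : 0 ≤ m) (hΔ : 0 ≤ Δ) (hL : 0 ≤ L) :
    0 ≤ 2 * ((Δ + L + 2) ^ 2 + m + 1) * Δ + ((Δ + L + 2) ^ 2 + m + 1) * ((Δ + L + 2) ^ 2 + m + 1 - 3)
      - L * (L + 1) - 1 := by
  have key : 2 * ((Δ + L + 2) ^ 2 + m + 1) * Δ
        + ((Δ + L + 2) ^ 2 + m + 1) * ((Δ + L + 2) ^ 2 + m + 1 - 3) - L * (L + 1) - 1 = (1 : ℝ) * L^4 + (4 : ℝ) * Δ * L^3 + (6 : ℝ) * Δ^2 * L^2 + (4 : ℝ) * Δ^3 * L + (1 : ℝ) * Δ^4 + (8 : ℝ) * L^3 + (26 : ℝ) * Δ * L^2 + (28 : ℝ) * Δ^2 * L + (10 : ℝ) * Δ^3 + (2 : ℝ) * m * L^2 + (4 : ℝ) * m * Δ * L + (2 : ℝ) * m * Δ^2 + (22 : ℝ) * L^2 + (54 :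 ℝ) * Δ * L + (31 : ℝ) * Δ^2 + (8 : ℝ) * m * L + (10 : ℝ) * m * Δ + (1 : ℝ) * m^2 + (27 : ℝ) * L + (38 : ℝ) * Δ + (7 : ℝ) * m + (9 : ℝ) := by
    ring
  rw [key]
  positivity

/-! ### 3. The transfer inequality and polynomial growth of the level sums -/

/-- The large-level threshold `N₀(Δ,ℓ) = (Δ+ℓ+2)²`. [folklore] -/
noncomputable def hrThreshold (Δ : ℝ) (ℓ : ℕ) : ℝ := (Δ + ℓ + 2) ^ 2

/-- Beyond the threshold every pivot of the next level is `≥ 1`. [cite: HogervorstRychkov2013, §2.2 eq. (2.27)] -/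
theorem one_le_casimirPivot3D_succ {Δ : ℝ} {ℓ n : ℕ} (hΔ : 0 ≤ Δ) (hn : hrThreshold Δ ℓ ≤ n)
    (j : ℕ) : 1 ≤ casimirPivot3D Δ ℓ (n + 1) j := by
  obtain ⟨m, hm, hnm⟩ : ∃ m : ℝ, 0 ≤ m ∧ (n : ℝ) = (Δ + ℓ + 2) ^ 2 + m :=
    ⟨(n : ℝ) - (Δ + ℓ + 2) ^ 2, by unfold hrThreshold at hn; linarith, by ring⟩
  have hc := hrPivot_cert_shifted m Δ ℓ hm hΔ (Nat.cast_nonneg ℓ)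
  have hj : (0 : ℝ) ≤ (j : ℝ) * ((j : ℝ) + 1) := by positivity
  unfold casimirPivot3D
  push_cast
  rw [hnm]
  nlinarith [hc, hj]

/-- Beyond the threshold the pivots of the next level are positive. [cite: HogervorstRychkov2013, §2.2 eq. (2.27)] -/
theorem casimirPivot3D_succ_pos {Δ : ℝ} {ℓ n : ℕ} (hΔ : 0 ≤ Δ) (hn : hrThreshold Δ ℓ ≤ n)
    (j : ℕ) : 0 < casimirPivot3D Δ ℓ (n + 1) j :=
  lt_of_lt_of_le one_pos (one_le_casimirPivot3D_succ hΔ hn j)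

/-- Division bookkeeping for the transfer inequality, `j ≥ 1`. [folklore] -/
theorem transfer_div_le {gp gm Pp Pm s t : ℝ} (hPp : 0 < Pp) (hPm : 0 < Pm) (hs : 0 < s)
    (ht : 0 < t) (h : t * (gp * Pm + gm * Pp) ≤ (t + 4) * (s * Pp * Pm)) :
    gp / s / Pp + gm / s / Pm ≤ 1 + 4 / t := by
  rw [div_div, div_div, div_add_div _ _ (by positivity) (by positivity),
    div_le_iff₀ (by positivity), show (1 : ℝ) + 4 / t = (t + 4) / t by field_simp,
    div_mul_eq_mul_div, le_div_iff₀ ht]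
  nlinarith [mul_nonneg hs.le (sub_nonneg.mpr h), mul_pos hPp hPm]

/-- Division bookkeeping for the transfer inequality, `j = 0`. [folklore] -/
theorem transfer_div_le_zero {gp Pp s t : ℝ} (hPp : 0 < Pp) (hs : 0 < s) (ht : 0 < t)
    (h : t * gp ≤ (t + 4) * (s * Pp)) : gp / s / Pp ≤ 1 + 4 / t := by
  rw [div_div, div_le_iff₀ (by positivity), show (1 : ℝ) + 4 / t = (t + 4) / t by field_simp,
    div_mul_eq_mul_div, le_div_iff₀ ht]
  nlinarith [h]

/-- **The transfer inequality**: for `n ≥ (Δ+ℓ+2)²` (and `Δ ≥ 0`), `W(n,j) ≤ 1 + 4/(n+1)` for every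
`j`. [cite: HogervorstRychkov2013, §2.2 eq. (2.27)] -/
theorem hrTransferWeight_le {Δ : ℝ} {ℓ n : ℕ} (hΔ : 0 ≤ Δ) (hn : hrThreshold Δ ℓ ≤ n) (j : ℕ) :
    hrTransferWeight Δ ℓ n j ≤ 1 + 4 / ((n : ℝ) + 1) := by
  obtain ⟨m, hm, hnm⟩ : ∃ m : ℝ, 0 ≤ m ∧ (n : ℝ) = (Δ + ℓ + 2) ^ 2 + m :=
    ⟨(n : ℝ) - (Δ + ℓ + 2) ^ 2, by unfold hrThreshold at hn; linarith, by ring⟩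
  have hL : (0 : ℝ) ≤ (ℓ : ℝ) := Nat.cast_nonneg ℓ
  have hn1 : (0 : ℝ) < (n : ℝ) + 1 := by positivity
  have hP : ∀ j' : ℕ, 0 < casimirPivot3D Δ ℓ (n + 1) j' := casimirPivot3D_succ_pos hΔ hn
  unfold hrTransferWeight
  rcases Nat.eq_zero_or_pos j with hj0 | hjpos
  · -- `j = 0`: only the `γ⁺` term survives, `W = (Δ+n)²/P₁`
    subst hj0
    rw [hrGammaMinus_zero, zero_div, add_zero]
    unfold hrGammaPlus
    refine transfer_div_le_zero (hP (0 + 1)) (by positivity) hn1 ?_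
    have hc := hrTransfer_cert_zero_shifted m Δ ℓ hm hΔ hL
    unfold casimirPivot3D
    push_cast
    rw [hnm]
    linarith [hc]
  · -- `j ≥ 1`
    have hj1 : 1 ≤ j := hjpos
    obtain ⟨i, hi, hji⟩ : ∃ i : ℝ, 0 ≤ i ∧ (j : ℝ) = 1 + i :=
      ⟨(j : ℝ) - 1, sub_nonneg.mpr (by exact_mod_cast hj1), by ring⟩
    have hcast : ((j - 1 : ℕ) : ℝ) = (j : ℝ) - 1 := by
      rw [Nat.cast_sub hj1, Nat.cast_one]
    have h2j : (0 : ℝ) < 2 * (j : ℝ) + 1 := by positivity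
    unfold hrGammaPlus hrGammaMinus
    refine transfer_div_le (hP (j + 1)) (hP (j - 1)) h2j hn1 ?_
    have hc := hrTransfer_cert_shifted m i Δ ℓ hm hi hΔ hL
    unfold casimirPivot3D
    push_cast
    rw [hcast, hnm, hji]
    linarith [hc]

/-- **Growth step.** Above the unitarity bound and beyond the threshold,
`Σ_j A_{n+1,j} ≤ (1 + 4/(n+1)) Σ_j A_{n,j}`. [cite: HogervorstRychkov2013, §2.2 eq. (2.27)] -/
theorem hrLevelSum_succ_le {Δ : ℝ} {ℓ n : ℕ} (hΔ : unitarityBound3D ℓ < Δ)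
    (hn : hrThreshold Δ ℓ ≤ n) :
    hrLevelSum Δ ℓ (n + 1) ≤ (1 + 4 / ((n : ℝ) + 1)) * hrLevelSum Δ ℓ n := by
  have hΔ0 : 0 ≤ Δ := by
    have := one_half_lt_of_unitarityBound3D_lt hΔ
    linarith
  rw [hrLevelSum_succ_eq_sum_transfer, hrLevelSum, Finset.mul_sum]
  exact Finset.sum_le_sum fun j _ =>
    mul_le_mul_of_nonneg_right (hrTransferWeight_le hΔ0 hn j) (hrCoeff_nonneg hΔ n j)

/-- The quartic comparison sequence `q(n) = (n+1)(n+2)(n+3)(n+4)`; it satisfies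
`(1 + 4/(n+1)) q(n) = q(n+1)` exactly. [folklore] -/
noncomputable def quarticWeight (n : ℕ) : ℝ :=
  ((n : ℝ) + 1) * ((n : ℝ) + 2) * ((n : ℝ) + 3) * ((n : ℝ) + 4)

/-- `q(n) ≥ 1`. [folklore] -/
theorem one_le_quarticWeight (n : ℕ) : 1 ≤ quarticWeight n := by
  unfold quarticWeight
  have h : (0 : ℝ) ≤ (n : ℝ) := Nat.cast_nonneg n
  have h1 : (1 : ℝ) ≤ (n : ℝ) + 1 := by linarith
  have h2 : (1 : ℝ) ≤ (n : ℝ) + 2 := by linarith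
  have h3 : (1 : ℝ) ≤ (n : ℝ) + 3 := by linarith
  have h4 : (1 : ℝ) ≤ (n : ℝ) + 4 := by linarith
  exact one_le_mul_of_one_le_of_one_le
    (one_le_mul_of_one_le_of_one_le (one_le_mul_of_one_le_of_one_le h1 h2) h3) h4

/-- `q(n) > 0`. [folklore] -/
theorem quarticWeight_pos (n : ℕ) : 0 < quarticWeight n :=
  lt_of_lt_of_le one_pos (one_le_quarticWeight n)

/-- The exact step `(1 + 4/(n+1)) q(n) = q(n+1)`. [folklore] -/
theorem quarticWeight_succ (n : ℕ) :
    (1 + 4 / ((n : ℝ) + 1)) * quarticWeight n = quarticWeight (n + 1) := by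
  unfold quarticWeight
  have hn1 : (n : ℝ) + 1 ≠ 0 := by positivity
  push_cast
  field_simp
  ring

/-- **Polynomial growth of the `z`-series level sums** (ours; Hogervorst–Rychkov state the
convergence of the `z`-series on `|z| < 1` — their §2.1 — which is equivalent to subexponential
growth): strictly above the unitarity bound there is `C ≥ 0` with `Σ_j A_{n,j}(Δ,ℓ) ≤ C (n+1)(n+2)(n+3)(n+4)`
for every level `n`. [cite: HogervorstRychkov2013, §2.1] -/
theorem hrLevelSum_le_quartic {Δ : ℝ} {ℓ : ℕ} (hΔ : unitarityBound3D ℓ < Δ) :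
    ∃ C : ℝ, 0 ≤ C ∧ ∀ n : ℕ, hrLevelSum Δ ℓ n ≤ C * quarticWeight n := by
  set N₁ := ⌈hrThreshold Δ ℓ⌉₊ with hN₁
  have hthr : ∀ n : ℕ, N₁ ≤ n → hrThreshold Δ ℓ ≤ n := fun n hn => Nat.ceil_le.mp hn
  set C := ∑ k ∈ range (N₁ + 1), hrLevelSum Δ ℓ k with hC
  have hC0 : 0 ≤ C := Finset.sum_nonneg fun k _ => hrLevelSum_nonneg hΔ k
  have hle : ∀ k : ℕ, k ≤ N₁ → hrLevelSum Δ ℓ k ≤ C := fun k hk =>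
    Finset.single_le_sum (f := fun k => hrLevelSum Δ ℓ k) (fun k _ => hrLevelSum_nonneg hΔ k)
      (mem_range.mpr (Nat.lt_succ_of_le hk))
  have hbase : ∀ k : ℕ, k ≤ N₁ → hrLevelSum Δ ℓ k ≤ C * quarticWeight k := fun k hk =>
    calc hrLevelSum Δ ℓ k ≤ C := hle k hk
      _ = C * 1 := (mul_one C).symm
      _ ≤ C * quarticWeight k := mul_le_mul_of_nonneg_left (one_le_quarticWeight k) hC0
  have main : ∀ k : ℕ, hrLevelSum Δ ℓ (N₁ + k) ≤ C * quarticWeight (N₁ + k) := by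
    intro k
    induction k with
    | zero => exact hbase _ le_rfl
    | succ k ih =>
      have hq : 0 ≤ 1 + 4 / (((N₁ + k : ℕ) : ℝ) + 1) := by positivity
      calc hrLevelSum Δ ℓ (N₁ + (k + 1)) = hrLevelSum Δ ℓ (N₁ + k + 1) := by rw [Nat.add_assoc]
        _ ≤ (1 + 4 / (((N₁ + k : ℕ) : ℝ) + 1)) * hrLevelSum Δ ℓ (N₁ + k) :=
            hrLevelSum_succ_le hΔ (hthr _ (Nat.le_add_right _ _))
        _ ≤ (1 + 4 / (((N₁ + k : ℕ) : ℝ) + 1)) * (C * quarticWeight (N₁ + k)) :=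
            mul_le_mul_of_nonneg_left ih hq
        _ = C * quarticWeight (N₁ + k + 1) := by
            rw [← quarticWeight_succ (N₁ + k)]; ring
        _ = C * quarticWeight (N₁ + (k + 1)) := by rw [Nat.add_assoc]
  refine ⟨C, hC0, fun n => ?_⟩
  rcases le_or_gt n N₁ with hn | hn
  · exact hbase n hn
  · obtain ⟨k, rfl⟩ := Nat.exists_eq_add_of_le hn.le
    exact main k

/-! ### 4. Absolute convergence of the Hogervorst–Rychkov double series on the unit bidisk -/

/-- `q(m+n) ≤ q(m) q(n)`. [folklore] -/
theorem quarticWeight_add_le (m n : ℕ) :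
    quarticWeight (m + n) ≤ quarticWeight m * quarticWeight n := by
  unfold quarticWeight
  have hm : (0 : ℝ) ≤ (m : ℝ) := Nat.cast_nonneg m
  have hn : (0 : ℝ) ≤ (n : ℝ) := Nat.cast_nonneg n
  push_cast
  have h1 : (m : ℝ) + n + 1 ≤ ((m : ℝ) + 1) * ((n : ℝ) + 1) := by nlinarith
  have h2 : (m : ℝ) + n + 2 ≤ ((m : ℝ) + 2) * ((n : ℝ) + 2) := by nlinarith
  have h3 : (m : ℝ) + n + 3 ≤ ((m : ℝ) + 3) * ((n : ℝ) + 3) := by nlinarith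
  have h4 : (m : ℝ) + n + 4 ≤ ((m : ℝ) + 4) * ((n : ℝ) + 4) := by nlinarith
  calc ((m : ℝ) + n + 1) * ((m : ℝ) + n + 2) * ((m : ℝ) + n + 3) * ((m : ℝ) + n + 4)
      ≤ (((m : ℝ) + 1) * ((n : ℝ) + 1)) * (((m : ℝ) + 2) * ((n : ℝ) + 2))
          * (((m : ℝ) + 3) * ((n : ℝ) + 3)) * (((m : ℝ) + 4) * ((n : ℝ) + 4)) := by
        gcongr
    _ = ((m : ℝ) + 1) * ((m : ℝ) + 2) * ((m : ℝ) + 3) * ((m : ℝ) + 4)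
          * (((n : ℝ) + 1) * ((n : ℝ) + 2) * ((n : ℝ) + 3) * ((n : ℝ) + 4)) := by ring

/-- `q` is monotone. [folklore] -/
theorem quarticWeight_mono {m n : ℕ} (h : m ≤ n) : quarticWeight m ≤ quarticWeight n := by
  unfold quarticWeight
  have hm : (0 : ℝ) ≤ (m : ℝ) := Nat.cast_nonneg m
  have hmn : (m : ℝ) ≤ (n : ℝ) := by exact_mod_cast h
  gcongr

/-- `Σ_n q(n) t^n` converges for `0 ≤ t < 1` (polynomial times geometric). [folklore] -/
theorem summable_quarticWeight_mul_pow {t : ℝ} (ht0 : 0 ≤ t) (ht1 : t < 1) :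
    Summable fun n : ℕ => quarticWeight n * t ^ n := by
  have ht : ‖t‖ < 1 := by rwa [Real.norm_eq_abs, abs_of_nonneg ht0]
  have h4 := summable_pow_mul_geometric_of_norm_lt_one 4 ht
  have h3 := summable_pow_mul_geometric_of_norm_lt_one 3 ht
  have h2 := summable_pow_mul_geometric_of_norm_lt_one 2 ht
  have h1 := summable_pow_mul_geometric_of_norm_lt_one 1 ht
  have h0 := summable_pow_mul_geometric_of_norm_lt_one 0 ht
  refine ((((h4.add (h3.mul_left 10)).add (h2.mul_left 35)).add (h1.mul_left 50)).add
    (h0.mul_left 24)).congr fun n => ?_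
  unfold quarticWeight
  ring

/-- A coefficient is at most its antidiagonal sum (all coefficients are `≥ 0` above the unitarity
bound). [cite: HogervorstRychkov2013, §2.2 eq. (2.27)] -/
theorem hrMonomialCoeff_le_diagCoeff {Δ : ℝ} {ℓ : ℕ} (hΔ : unitarityBound3D ℓ < Δ) (p : ℕ × ℕ) :
    hrMonomialCoeff Δ ℓ p ≤ diagCoeff (hrMonomialCoeff Δ ℓ) (p.1 + p.2) := by
  unfold diagCoeff
  exact Finset.single_le_sum (f := fun p => hrMonomialCoeff Δ ℓ p)
    (fun q _ => hrMonomialCoeff_nonneg hΔ q) (mem_antidiagonal.mpr rfl)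

/-- **Polynomial bound on the antidiagonal sums** `d_N = Σ_{m+n=N} k_{mn}` of the HR array:
`d_N ≤ C' q(N)` for all `N` (zero below degree `ℓ`, `= (Σ_j A_{N-ℓ,j})/λ_ℓ` from degree `ℓ` on).
[cite: HogervorstRychkov2013, §2.1] -/
theorem diagCoeff_hrMonomialCoeff_le_quartic {Δ : ℝ} {ℓ : ℕ} (hΔ : unitarityBound3D ℓ < Δ) :
    ∃ C : ℝ, 0 ≤ C ∧ ∀ N : ℕ, diagCoeff (hrMonomialCoeff Δ ℓ) N ≤ C * quarticWeight N := by
  obtain ⟨C, hC0, hC⟩ := hrLevelSum_le_quartic hΔ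
  have hlam := legendreLam_pos ℓ
  refine ⟨C / legendreLam ℓ, div_nonneg hC0 hlam.le, fun N => ?_⟩
  rcases Nat.lt_or_ge N ℓ with hN | hN
  · -- below degree `ℓ` every coefficient vanishes
    have h0 : diagCoeff (hrMonomialCoeff Δ ℓ) N = 0 := by
      unfold diagCoeff
      exact Finset.sum_eq_zero fun p hp =>
        hrMonomialCoeff_eq_zero_of_lt Δ ℓ (by rw [mem_antidiagonal.mp hp]; exact hN)
    rw [h0]
    exact mul_nonneg (div_nonneg hC0 hlam.le) (quarticWeight_pos N).le
  · obtain ⟨n, rfl⟩ := Nat.exists_eq_add_of_le hN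
    rw [diagCoeff_hrMonomialCoeff, div_le_iff₀ hlam]
    calc hrLevelSum Δ ℓ n ≤ C * quarticWeight n := hC n
      _ ≤ C * quarticWeight (ℓ + n) :=
          mul_le_mul_of_nonneg_left (quarticWeight_mono (Nat.le_add_left n ℓ)) hC0
      _ = C / legendreLam ℓ * quarticWeight (ℓ + n) * legendreLam ℓ := by
          field_simp

/-- **Absolute convergence on the bidisk, radial form**: for `0 ≤ t < 1` the family
`k_{mn} t^{m+n}` is summable over `ℕ × ℕ` (comparison with the product family
`C' q(m) t^m · q(n) t^n`). This is the convergence of the `z`-series of the block on `|z| < 1`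
stated in Hogervorst–Rychkov §2.1, proved here from the recursion alone.
[cite: HogervorstRychkov2013, §2.1] -/
theorem summable_hrMonomialCoeff_mul_pow {Δ : ℝ} {ℓ : ℕ} (hΔ : unitarityBound3D ℓ < Δ) {t : ℝ}
    (ht0 : 0 ≤ t) (ht1 : t < 1) :
    Summable fun p : ℕ × ℕ => hrMonomialCoeff Δ ℓ p * t ^ (p.1 + p.2) := by
  obtain ⟨C, hC0, hC⟩ := diagCoeff_hrMonomialCoeff_le_quartic hΔ
  have hg := summable_quarticWeight_mul_pow ht0 ht1
  have hprod : Summable fun x : ℕ × ℕ =>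
      (quarticWeight x.1 * t ^ x.1) * (quarticWeight x.2 * t ^ x.2) :=
    hg.mul_of_nonneg hg (fun m => mul_nonneg (quarticWeight_pos m).le (pow_nonneg ht0 _))
      (fun m => mul_nonneg (quarticWeight_pos m).le (pow_nonneg ht0 _))
  refine Summable.of_nonneg_of_le (fun p => mul_nonneg (hrMonomialCoeff_nonneg hΔ p) (pow_nonneg ht0 _))
    (fun p => ?_) (hprod.mul_left C)
  calc hrMonomialCoeff Δ ℓ p * t ^ (p.1 + p.2)
      ≤ (C * quarticWeight (p.1 + p.2)) * t ^ (p.1 + p.2) :=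
        mul_le_mul_of_nonneg_right ((hrMonomialCoeff_le_diagCoeff hΔ p).trans (hC _))
          (pow_nonneg ht0 _)
    _ ≤ (C * (quarticWeight p.1 * quarticWeight p.2)) * t ^ (p.1 + p.2) :=
        mul_le_mul_of_nonneg_right (mul_le_mul_of_nonneg_left (quarticWeight_add_le _ _) hC0)
          (pow_nonneg ht0 _)
    _ = C * ((quarticWeight p.1 * t ^ p.1) * (quarticWeight p.2 * t ^ p.2)) := by ring

/-! ### 5. The block defined by the series, and the typed power-series clause -/

/-- The Hogervorst–Rychkov double power series `K^{HR}_{Δ,ℓ}(z,z̄) = Σ_{m,n} k^{HR}_{mn} z^m z̄^n`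
(the `(z z̄)^{-α}`-stripped block; `k^{HR} = hrMonomialCoeff Δ ℓ`).
[cite: HogervorstRychkov2013, §2.1 eq. (2.16)] -/
noncomputable def hrSeries (Δ : ℝ) (ℓ : ℕ) (z zb : ℝ) : ℝ :=
  ∑' p : ℕ × ℕ, hrMonomialCoeff Δ ℓ p * z ^ p.1 * zb ^ p.2

/-- **The 3D conformal block of `(Δ, ℓ)` for equal external dimensions, as a function on the square**:
`g^{HR}_{Δ,ℓ}(z,z̄) = (z z̄)^{(Δ-ℓ)/2} K^{HR}_{Δ,ℓ}(z,z̄)` — the sum of the Hogervorst–Rychkov `z`-series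
in Dolan–Osborn normalisation `k_{ℓ0} = 1`. [cite: HogervorstRychkov2013, §2.1 eq. (2.16)] -/
noncomputable def hrBlock (Δ : ℝ) (ℓ : ℕ) (z zb : ℝ) : ℝ :=
  (z * zb) ^ ((Δ - (ℓ : ℝ)) / 2) * hrSeries Δ ℓ z zb

/-- The typed clause `IsDoublePowerSeriesOn`: the HR array is absolutely summable against
`|z|^m |z̄|^n` on the open unit bidisk and `hrSeries` is its sum. [cite: HogervorstRychkov2013, §2.1] -/
theorem isDoublePowerSeriesOn_hrSeries {Δ : ℝ} {ℓ : ℕ} (hΔ : unitarityBound3D ℓ < Δ) :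
    IsDoublePowerSeriesOn (hrMonomialCoeff Δ ℓ) (hrSeries Δ ℓ) := by
  intro z zb hz hzb
  refine ⟨?_, rfl⟩
  set t := max |z| |zb| with ht
  have ht0 : 0 ≤ t := le_max_of_le_left (abs_nonneg z)
  have ht1 : t < 1 := max_lt hz hzb
  refine Summable.of_nonneg_of_le (fun p => by positivity) (fun p => ?_)
    (summable_hrMonomialCoeff_mul_pow hΔ ht0 ht1)
  rw [abs_of_nonneg (hrMonomialCoeff_nonneg hΔ p), pow_add, mul_assoc]
  exact mul_le_mul_of_nonneg_left (mul_le_mul (pow_le_pow_left₀ (abs_nonneg z) (le_max_left _ _) _)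
    (pow_le_pow_left₀ (abs_nonneg zb) (le_max_right _ _) _) (pow_nonneg (abs_nonneg zb) _)
    (pow_nonneg ht0 _)) (hrMonomialCoeff_nonneg hΔ p)

/-! ### 6. The coefficient system implies the Casimir equation -/

/-- **The converse of the extraction theorem.** For `g = (z z̄)^{(Δ-ℓ)/2} K`, `K = Σ k_{mn} z^m z̄^n`
absolutely convergent on the unit bidisk, the five-term monomial system
`SatisfiesCoeffCasimir (-Δ₁₂/2) (Δ₃₄/2) Δ ℓ k` implies the quadratic Casimir equation on `(0,1)²`
(termwise differentiation as in `satisfiesCoeffCasimir_of_casimirEq3D`, then the Casimir expression is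
`(z z̄)^α Σ_{P,Q} E_{PQ} z^P z̄^Q` with every `E_{PQ} = 0`). Valid for all external dimensions.
[cite: DolanOsborn2011, §2 eqs. (2.9)–(2.12)] -/
theorem casimirEq3D_of_satisfiesCoeffCasimir {Δ₁₂ Δ₃₄ Δ : ℝ} {ℓ : ℕ} {g : ℝ → ℝ → ℝ}
    {k : ℕ × ℕ → ℝ} {K : ℝ → ℝ → ℝ} (hS : IsDoublePowerSeriesOn k K)
    (hg : ∀ z zb : ℝ, z ∈ Ioo (0 : ℝ) 1 → zb ∈ Ioo (0 : ℝ) 1 →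
      g z zb = (z * zb) ^ ((Δ - (ℓ : ℝ)) / 2) * K z zb)
    (hk : SatisfiesCoeffCasimir (-Δ₁₂ / 2) (Δ₃₄ / 2) Δ ℓ k) :
    ∀ z zb : ℝ, z ∈ Ioo (0 : ℝ) 1 → zb ∈ Ioo (0 : ℝ) 1 → CasimirEq3D Δ₁₂ Δ₃₄ Δ ℓ g z zb := by
  intro z zb hz hzb
  obtain ⟨hz0, hz1⟩ := hz
  obtain ⟨hzb0, hzb1⟩ := hzb
  have hg' : ∀ z zb : ℝ, z ∈ Ioo (0 : ℝ) 1 → zb ∈ Ioo (0 : ℝ) 1 →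
      g z zb = (z * zb) ^ (halfTwist Δ ℓ) * K z zb := fun z zb hz hzb => by
    rw [hg z zb hz hzb]; rfl
  -- the two partial functions of `g` are generalised power series on `(0,1)`
  have G1 : GeomSummable (fun p : ℕ × ℕ => k p * (zb ^ (halfTwist Δ ℓ) * zb ^ p.2)) Prod.fst :=
    hS.geomSummable_fst hzb0.le hzb1 _
  have G2 : GeomSummable (fun p : ℕ × ℕ => k p * (z ^ (halfTwist Δ ℓ) * z ^ p.1)) Prod.snd :=
    hS.geomSummable_snd hz0.le hz1 _
  have E1 : EqOn (fun t => g t zb)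
      (gps (fun p : ℕ × ℕ => k p * (zb ^ (halfTwist Δ ℓ) * zb ^ p.2)) Prod.fst (halfTwist Δ ℓ))
      (Ioo 0 1) := by
    intro t ht
    simp only [gps]
    rw [hg' t zb ht ⟨hzb0, hzb1⟩, hS.eq_tsum ht.1.le ht.2 hzb0.le hzb1, Real.mul_rpow ht.1.le hzb0.le,
      ← tsum_mul_left]
    refine tsum_congr fun p => ?_
    rw [Real.rpow_add ht.1, Real.rpow_natCast]; ring
  have E2 : EqOn (fun t => g z t)
      (gps (fun p : ℕ × ℕ => k p * (z ^ (halfTwist Δ ℓ) * z ^ p.1)) Prod.snd (halfTwist Δ ℓ))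
      (Ioo 0 1) := by
    intro t ht
    simp only [gps]
    rw [hg' z t ⟨hz0, hz1⟩ ht, hS.eq_tsum hz0.le hz1 ht.1.le ht.2, Real.mul_rpow hz0.le ht.1.le,
      ← tsum_mul_left]
    refine tsum_congr fun p => ?_
    rw [Real.rpow_add ht.1, Real.rpow_natCast]; ring
  have e1 := Filter.eventuallyEq_of_mem (Ioo_mem_nhds hz0 hz1) E1
  have e2 := Filter.eventuallyEq_of_mem (Ioo_mem_nhds hzb0 hzb1) E2
  have gz : g z zb = gps (fun p : ℕ × ℕ => k p * (zb ^ (halfTwist Δ ℓ) * zb ^ p.2)) Prod.fst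
      (halfTwist Δ ℓ) z := E1 ⟨hz0, hz1⟩
  -- the six `HasSum`s
  have hT1 := G1.hasSum_gps hz0 hz1 (halfTwist Δ ℓ)
  have hT1' := (G1.mul_weight (halfTwist Δ ℓ)).hasSum_gps hz0 hz1 (halfTwist Δ ℓ - 1)
  have hT1'' := ((G1.mul_weight (halfTwist Δ ℓ)).mul_weight (halfTwist Δ ℓ - 1)).hasSum_gps hz0 hz1
    (halfTwist Δ ℓ - 1 - 1)
  have hT2 := G2.hasSum_gps hzb0 hzb1 (halfTwist Δ ℓ)
  have hT2' := (G2.mul_weight (halfTwist Δ ℓ)).hasSum_gps hzb0 hzb1 (halfTwist Δ ℓ - 1)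
  have hT2'' := ((G2.mul_weight (halfTwist Δ ℓ)).mul_weight (halfTwist Δ ℓ - 1)).hasSum_gps hzb0
    hzb1 (halfTwist Δ ℓ - 1 - 1)
  have hL := ((((((hT1''.mul_left (z ^ 2 * (1 - z))).sub
      (hT1'.mul_left (((-Δ₁₂ / 2) + Δ₃₄ / 2 + 1) * z ^ 2))).sub
      (hT1.mul_left ((-Δ₁₂ / 2) * (Δ₃₄ / 2) * z))).add
      (((hT2''.mul_left (zb ^ 2 * (1 - zb))).sub
        (hT2'.mul_left (((-Δ₁₂ / 2) + Δ₃₄ / 2 + 1) * zb ^ 2))).sub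
        (hT2.mul_left ((-Δ₁₂ / 2) * (Δ₃₄ / 2) * zb)))).sub
      (hT1.mul_left (casimirEigenvalue3D Δ ℓ))).mul_left (z - zb)).add
    (((hT1'.mul_left (1 - z)).sub (hT2'.mul_left (1 - zb))).mul_left (z * zb))
  -- the Casimir expression, rewritten through the six generalised power series
  have hz : z ∈ Ioo (0 : ℝ) 1 := ⟨hz0, hz1⟩
  have hzb : zb ∈ Ioo (0 : ℝ) 1 := ⟨hzb0, hzb1⟩
  unfold CasimirEq3D
  rw [dolanOsbornD_congr_of_eventuallyEq e1, dolanOsbornD_congr_of_eventuallyEq e2, e1.deriv_eq,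
    e2.deriv_eq, G1.dolanOsbornD_gps _ _ _ hz, G2.dolanOsbornD_gps _ _ _ hzb, G1.deriv_gps _ hz,
    G2.deriv_gps _ hzb, gz]
  -- termwise, the summand of `hL` is `(z z̄)^α k_p Ψ_p` with `Ψ_p` the five weighted monomials
  have R1 : ∀ (m : ℕ) (β : ℝ), z ^ ((m : ℝ) + β) = z ^ β * z ^ m := fun m β => by
    rw [Real.rpow_add hz0, Real.rpow_natCast, mul_comm]
  have R2 : ∀ (m : ℕ) (β : ℝ), zb ^ ((m : ℝ) + β) = zb ^ β * zb ^ m := fun m β => by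
    rw [Real.rpow_add hzb0, Real.rpow_natCast, mul_comm]
  have hzne : z ≠ 0 := hz0.ne'
  have hzbne : zb ≠ 0 := hzb0.ne'
  have hFeq : (fun p : ℕ × ℕ =>
      (z - zb) *
          (z ^ 2 * (1 - z) *
                    (k p * (zb ^ halfTwist Δ ℓ * zb ^ p.2) * (↑p.1 + halfTwist Δ ℓ) *
                      (↑p.1 + (halfTwist Δ ℓ - 1)) * z ^ (↑p.1 + (halfTwist Δ ℓ - 1 - 1))) -
                  (-Δ₁₂ / 2 + Δ₃₄ / 2 + 1) * z ^ 2 *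
                    (k p * (zb ^ halfTwist Δ ℓ * zb ^ p.2) * (↑p.1 + halfTwist Δ ℓ) *
                      z ^ (↑p.1 + (halfTwist Δ ℓ - 1))) -
                -Δ₁₂ / 2 * (Δ₃₄ / 2) * z *
                  (k p * (zb ^ halfTwist Δ ℓ * zb ^ p.2) * z ^ (↑p.1 + halfTwist Δ ℓ)) +
              (zb ^ 2 * (1 - zb) *
                    (k p * (z ^ halfTwist Δ ℓ * z ^ p.1) * (↑p.2 + halfTwist Δ ℓ) *
                      (↑p.2 + (halfTwist Δ ℓ - 1)) * zb ^ (↑p.2 + (halfTwist Δ ℓ - 1 - 1))) -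
                  (-Δ₁₂ / 2 + Δ₃₄ / 2 + 1) * zb ^ 2 *
                    (k p * (z ^ halfTwist Δ ℓ * z ^ p.1) * (↑p.2 + halfTwist Δ ℓ) *
                      zb ^ (↑p.2 + (halfTwist Δ ℓ - 1))) -
                -Δ₁₂ / 2 * (Δ₃₄ / 2) * zb *
                  (k p * (z ^ halfTwist Δ ℓ * z ^ p.1) * zb ^ (↑p.2 + halfTwist Δ ℓ))) -
            casimirEigenvalue3D Δ ℓ * (k p * (zb ^ halfTwist Δ ℓ * zb ^ p.2) * z ^ (↑p.1 + halfTwist Δ ℓ))) +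
        z * zb *
          ((1 - z) *
              (k p * (zb ^ halfTwist Δ ℓ * zb ^ p.2) * (↑p.1 + halfTwist Δ ℓ) *
                z ^ (↑p.1 + (halfTwist Δ ℓ - 1))) -
            (1 - zb) *
              (k p * (z ^ halfTwist Δ ℓ * z ^ p.1) * (↑p.2 + halfTwist Δ ℓ) *
                zb ^ (↑p.2 + (halfTwist Δ ℓ - 1))))) =
      fun p : ℕ × ℕ => (z * zb) ^ (halfTwist Δ ℓ) *
        (coeffA Δ ℓ p.1 p.2 * k p * z ^ (p.1 + 1) * zb ^ p.2
          + coeffB Δ ℓ p.1 p.2 * k p * z ^ p.1 * zb ^ (p.2 + 1)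
          + coeffC (-Δ₁₂ / 2) (Δ₃₄ / 2) Δ ℓ p.1 * k p * z ^ (p.1 + 2) * zb ^ p.2
          + coeffD (-Δ₁₂ / 2) (Δ₃₄ / 2) Δ ℓ p.1 p.2 * k p * z ^ (p.1 + 1) * zb ^ (p.2 + 1)
          + coeffE (-Δ₁₂ / 2) (Δ₃₄ / 2) Δ ℓ p.2 * k p * z ^ p.1 * zb ^ (p.2 + 2)) := by
    funext p
    simp only [R1, R2, Real.rpow_sub_one hzne, Real.rpow_sub_one hzbne,
      Real.mul_rpow hz0.le hzb0.le, coeffA, coeffB, coeffC, coeffD, coeffE]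
    field_simp
    ring
  rw [hFeq] at hL
  -- the five pieces and their pushforwards to the monomial `z^P z̄^Q`
  have sA := hS.summable_pieceA hz0.le hz1 hzb0.le hzb1 Δ ℓ
  have sB := hS.summable_pieceB hz0.le hz1 hzb0.le hzb1 Δ ℓ
  have sC := hS.summable_pieceC hz0.le hz1 hzb0.le hzb1 (-Δ₁₂ / 2) (Δ₃₄ / 2) Δ ℓ
  have sD := hS.summable_pieceD hz0.le hz1 hzb0.le hzb1 (-Δ₁₂ / 2) (Δ₃₄ / 2) Δ ℓ
  have sE := hS.summable_pieceE hz0.le hz1 hzb0.le hzb1 (-Δ₁₂ / 2) (Δ₃₄ / 2) Δ ℓ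
  have hP5 := (((sA.hasSum.add sB.hasSum).add sC.hasSum).add sD.hasSum).add sE.hasSum
  have hP := hP5.mul_left ((z * zb) ^ (halfTwist Δ ℓ))
  have hfin := hL.unique hP
  have hA := hasSum_shift10
    (G := fun q : ℕ × ℕ => coeffA Δ ℓ (q.1 - 1) q.2 * k (q.1 - 1, q.2) * z ^ q.1 * zb ^ q.2)
    (by simpa using sA.hasSum)
  have hB := hasSum_shift01
    (G := fun q : ℕ × ℕ => coeffB Δ ℓ q.1 (q.2 - 1) * k (q.1, q.2 - 1) * z ^ q.1 * zb ^ q.2)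
    (by simpa using sB.hasSum)
  have hC' := hasSum_shift20
    (G := fun q : ℕ × ℕ =>
      coeffC (-Δ₁₂ / 2) (Δ₃₄ / 2) Δ ℓ (q.1 - 2) * k (q.1 - 2, q.2) * z ^ q.1 * zb ^ q.2)
    (by simpa using sC.hasSum)
  have hD := hasSum_shift11
    (G := fun q : ℕ × ℕ =>
      coeffD (-Δ₁₂ / 2) (Δ₃₄ / 2) Δ ℓ (q.1 - 1) (q.2 - 1) * k (q.1 - 1, q.2 - 1) * z ^ q.1
        * zb ^ q.2)
    (by simpa using sD.hasSum)
  have hE := hasSum_shift02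
    (G := fun q : ℕ × ℕ =>
      coeffE (-Δ₁₂ / 2) (Δ₃₄ / 2) Δ ℓ (q.2 - 2) * k (q.1, q.2 - 2) * z ^ q.1 * zb ^ q.2)
    (by simpa using sE.hasSum)
  have hq := (((hA.add hB).add hC').add hD).add hE
  have hqL : HasSum (fun q : ℕ × ℕ =>
      coeffCasimirLHS (-Δ₁₂ / 2) (Δ₃₄ / 2) Δ ℓ k q.1 q.2 * z ^ q.1 * zb ^ q.2)
      ((∑' p : ℕ × ℕ, coeffA Δ ℓ p.1 p.2 * k p * z ^ (p.1 + 1) * zb ^ p.2)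
        + (∑' p : ℕ × ℕ, coeffB Δ ℓ p.1 p.2 * k p * z ^ p.1 * zb ^ (p.2 + 1))
        + (∑' p : ℕ × ℕ, coeffC (-Δ₁₂ / 2) (Δ₃₄ / 2) Δ ℓ p.1 * k p * z ^ (p.1 + 2) * zb ^ p.2)
        + (∑' p : ℕ × ℕ,
            coeffD (-Δ₁₂ / 2) (Δ₃₄ / 2) Δ ℓ p.1 p.2 * k p * z ^ (p.1 + 1) * zb ^ (p.2 + 1))
        + (∑' p : ℕ × ℕ,
            coeffE (-Δ₁₂ / 2) (Δ₃₄ / 2) Δ ℓ p.2 * k p * z ^ p.1 * zb ^ (p.2 + 2))) := by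
    convert hq using 1
    funext q
    simp only [coeffCasimirLHS, add_mul, ite_mul, zero_mul]
  have hzero : (fun q : ℕ × ℕ =>
      coeffCasimirLHS (-Δ₁₂ / 2) (Δ₃₄ / 2) Δ ℓ k q.1 q.2 * z ^ q.1 * zb ^ q.2) = fun _ => 0 := by
    funext q
    rw [hk q.1 q.2, zero_mul, zero_mul]
  rw [hzero] at hqL
  have hS5 := hqL.unique hasSum_zero
  rw [hS5, mul_zero] at hfin
  linear_combination hfin

/-! ### 7. Existence: the Hogervorst–Rychkov block satisfies the typed predicate -/

/-- **Existence of the generic block (equal external dimensions).** For every `Δ` strictly above the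
3D unitarity bound the function `hrBlock Δ ℓ` satisfies the generic typed predicate
`IsConformalBlock3DAbove 0 0 Δ ℓ`: it is `(z z̄)^{(Δ-ℓ)/2}` times a symmetric absolutely convergent double
power series on the unit bidisk with the Dolan–Osborn boundary row `k_{m0} = δ_{mℓ}` (`m ≤ ℓ`), and it
solves the quadratic Casimir equation on `(0,1)²`. Accidental-degeneracy points included (there the
predicate has several solutions; this is one). [cite: HogervorstRychkov2013, §2.1 eq. (2.16)] -/
theorem isConformalBlock3DAbove_hrBlock {Δ : ℝ} {ℓ : ℕ} (hΔ : unitarityBound3D ℓ < Δ) :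
    IsConformalBlock3DAbove 0 0 Δ ℓ (hrBlock Δ ℓ) := by
  refine ⟨hrMonomialCoeff Δ ℓ, hrSeries Δ ℓ, isDoublePowerSeriesOn_hrSeries hΔ,
    hrMonomialCoeff_symm Δ ℓ, hrMonomialCoeff_hasLeadingPart Δ ℓ, fun z zb _ _ => rfl, ?_⟩
  have hk : SatisfiesCoeffCasimir (-(0 : ℝ) / 2) ((0 : ℝ) / 2) Δ ℓ (hrMonomialCoeff Δ ℓ) := by
    rw [neg_zero, zero_div]
    exact hrMonomialCoeff_satisfies hΔ
  exact casimirEq3D_of_satisfiesCoeffCasimir (isDoublePowerSeriesOn_hrSeries hΔ)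
    (fun z zb _ _ => rfl) hk

/-- **Existence of the genuine block at regular points.** Strictly above the unitarity bound and off
the accidental-degeneracy set, `hrBlock Δ ℓ` satisfies `IsConformalBlock3D 0 0 Δ ℓ` (the clause A2 of
the typed bootstrap axioms quantifies over functions satisfying this predicate; it is therefore not
vacuous at any regular point of the `σσσσ`/`εεεε` channels). [cite: HogervorstRychkov2013, §2.1 eq. (2.16)] -/
theorem isConformalBlock3D_hrBlock {Δ : ℝ} {ℓ : ℕ} (hΔ : unitarityBound3D ℓ < Δ)
    (hreg : ¬ accidentalDegeneracy3D Δ ℓ) : IsConformalBlock3D 0 0 Δ ℓ (hrBlock Δ ℓ) :=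
  Or.inl ⟨⟨hΔ.ne', hreg⟩, isConformalBlock3DAbove_hrBlock hΔ⟩

/-- **Satisfiability of A2 (equal external dimensions, regular points)**: the typed block predicate has
a solution. [cite: HogervorstRychkov2013, §2.1 eq. (2.16)] -/
theorem exists_isConformalBlock3D {Δ : ℝ} {ℓ : ℕ} (hΔ : unitarityBound3D ℓ < Δ)
    (hreg : ¬ accidentalDegeneracy3D Δ ℓ) : ∃ g : ℝ → ℝ → ℝ, IsConformalBlock3D 0 0 Δ ℓ g :=
  ⟨hrBlock Δ ℓ, isConformalBlock3D_hrBlock hΔ hreg⟩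

/-- **Existence and uniqueness together**: at a regular point, a function satisfies the generic
predicate `IsConformalBlock3DAbove 0 0 Δ ℓ` iff it agrees with `hrBlock Δ ℓ` on the open square — in
one direction `IsConformalBlock3DAbove.eqOn_of_isRegular` (uniqueness, `BlockCoefficientExtraction`),
in the other the existence theorem above. [cite: HogervorstRychkov2013, §2.2 eq. (2.27)] -/
theorem IsConformalBlock3DAbove.eq_hrBlock {Δ : ℝ} {ℓ : ℕ} {g : ℝ → ℝ → ℝ}
    (hΔ : unitarityBound3D ℓ < Δ) (hreg : ¬ accidentalDegeneracy3D Δ ℓ)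
    (h : IsConformalBlock3DAbove 0 0 Δ ℓ g) :
    ∀ z zb : ℝ, z ∈ Ioo (0 : ℝ) 1 → zb ∈ Ioo (0 : ℝ) 1 → g z zb = hrBlock Δ ℓ z zb :=
  h.eqOn_of_isRegular hΔ hreg (isConformalBlock3DAbove_hrBlock hΔ)

/-- The genuine block at a regular point IS `hrBlock` on the square. [cite: HogervorstRychkov2013, §2.2 eq. (2.27)] -/
theorem IsConformalBlock3D.eq_hrBlock {Δ : ℝ} {ℓ : ℕ} {g : ℝ → ℝ → ℝ}
    (hΔ : unitarityBound3D ℓ < Δ) (hreg : ¬ accidentalDegeneracy3D Δ ℓ)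
    (h : IsConformalBlock3D 0 0 Δ ℓ g) :
    ∀ z zb : ℝ, z ∈ Ioo (0 : ℝ) 1 → zb ∈ Ioo (0 : ℝ) 1 → g z zb = hrBlock Δ ℓ z zb := by
  rcases h with ⟨_, hA⟩ | ⟨hnreg, _⟩
  · exact hA.eq_hrBlock hΔ hreg
  · exact absurd ⟨hΔ.ne', hreg⟩ hnreg

/-! ### 8. Values: the series is positive on the square -/

/-- On `[0,1)²` the stripped series dominates its boundary term: `K^{HR}(z,z̄) ≥ k_{ℓ0} z^ℓ = z^ℓ`
(all coefficients `≥ 0`). [cite: HogervorstRychkov2013, §2.2 eq. (2.27)] -/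
theorem pow_le_hrSeries {Δ : ℝ} {ℓ : ℕ} (hΔ : unitarityBound3D ℓ < Δ) {z zb : ℝ}
    (hz0 : 0 ≤ z) (hz1 : z < 1) (hzb0 : 0 ≤ zb) (hzb1 : zb < 1) :
    z ^ ℓ ≤ hrSeries Δ ℓ z zb := by
  have hs := (isDoublePowerSeriesOn_hrSeries hΔ).summable hz0 hz1 hzb0 hzb1
  have hle := hs.le_tsum (ℓ, 0) (fun p _ => mul_nonneg (mul_nonneg (hrMonomialCoeff_nonneg hΔ p)
    (pow_nonneg hz0 _)) (pow_nonneg hzb0 _))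
  have hlead : hrMonomialCoeff Δ ℓ (ℓ, 0) = 1 := (hrMonomialCoeff_hasLeadingPart Δ ℓ).2
  unfold hrSeries
  simpa [hlead] using hle

/-- **The block is positive on the open square**: `hrBlock Δ ℓ z z̄ ≥ (z z̄)^{(Δ-ℓ)/2} z^ℓ > 0` for
`z, z̄ ∈ (0,1)` — non-negative coefficients and the normalisation `k_{ℓ0} = 1`.
[cite: HogervorstRychkov2013, §2.2 eq. (2.27)] -/
theorem hrBlock_pos {Δ : ℝ} {ℓ : ℕ} (hΔ : unitarityBound3D ℓ < Δ) {z zb : ℝ}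
    (hz : z ∈ Ioo (0 : ℝ) 1) (hzb : zb ∈ Ioo (0 : ℝ) 1) : 0 < hrBlock Δ ℓ z zb := by
  unfold hrBlock
  have h1 : 0 < (z * zb) ^ ((Δ - (ℓ : ℝ)) / 2) := Real.rpow_pos_of_pos (mul_pos hz.1 hzb.1) _
  have h2 : 0 < hrSeries Δ ℓ z zb :=
    lt_of_lt_of_le (pow_pos hz.1 ℓ) (pow_le_hrSeries hΔ hz.1.le hz.2 hzb.1.le hzb.2)
  exact mul_pos h1 h2

end Literature.MathematicalPhysics.QuantumFieldTheory.ConformalBootstrap3D
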